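import Summits.Ventures.Crystal3D.Theorems.StickyWulffConstantCoaxialWallLawEndRowIntModel
import HarnessLib

/-!
# An integer model of the typed census row, II: menu normals of the tilted frame, twin readings, end pairs, row domination

HONEST FRAMING. Venture `Summits/Ventures/Crystal3D` (cell `crystal3d-full`), helper `--supports` the crux `CoaxialWallLaw`
(stmt-Ventures-19481, line `WallLedgerF`).  Continues `…CoaxialWallLawEndRowIntModel` (seat 19481-p1 gen 12):

* §4 the menu normals of `L` are `menuOf (cubeInt c) = √6 · Qr (ipt (cubeInt c))` for the eight sign vectors
  (`exists_menuOf_of_menu`, from `menu_cubic_coords_pm_one`); `⟪L (slotSite i), menuOf k⟫ = (sᵢ·k)/√6`; the mirrored slot across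
  `menuOf k` is the integer vector `mirrorVec i k = 3 sᵢ − 2 (sᵢ·k) k`; hence twin readings at carried points are REFUTED by the
  Boolean test `twinFailS` (all eight `k`) and ESTABLISHED by `twinOKS`;
* §5 `¬ IsMoving` (v1) from `fullS = false` + `twinFailS`; straight end moves from FULL (`isEndMove_full`) or GLIDING
  (`isEndMove_glide`) predecessors; the plate systems `S1/S2 = ⟨L, inPlaneRoots L (±1)⟩` of `EndRowTrans` at `L`; roots are
  admissible with the empty chain; basal slots with non-zero rise number are roots (`root_of_ne`); exhibited end pairs bound
  `endMult` from below (`le_endMult`); and the domination `Σ_j m_j / pooledS (pt j) ≤ s_F` from `LocalEndRow v1 s_F S1 S2` at a payer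
  (`sum_le_of_localEndRow'`).
WHAT THIS IS NOT: no census constant is claimed here; F-C1 not moved.
-/

noncomputable section

namespace Summit.Ventures.Crystal3D.Theorems

open Summit.Ventures.Crystal3D Finset NearIdentity
open Literature.MathematicalPhysics.StatisticalMechanics (barlowPos fccStacking constHagg)
open scoped InnerProductSpace

namespace EndRowFloor

/-! ### §4 Menu normals of `L` and twin readings in the integer model -/

/-- `√18 = √6 · √3`. -/
theorem sqrt18_eq : Real.sqrt 18 = Real.sqrt 6 * Real.sqrt 3 := by
  rw [show (18 : ℝ) = 6 * 3 by norm_num, Real.sqrt_mul (by norm_num)]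

/-- `Cc (cubicFrame j)` is the `j`-th standard vector. -/
theorem Cc_cubicFrame (j : Fin 3) : Cc (cubicFrame j) = EuclideanSpace.single j 1 := by
  ext i
  rw [Cc_apply, cubicCoords_cubicFrame, PiLp.single_apply, Pi.single_apply]

/-- The menu normal attached to a sign vector `k`: `√6 · Qr (ipt k)`. -/
def menuOf (k : Fin 3 → ℤ) : EuclideanSpace ℝ (Fin 3) := Real.sqrt 6 • Qr (ipt k)

/-- `⟪L (slotSite i), menuOf k⟫ = (sᵢ · k)/√6`. -/
theorem inner_L_slotSite_menuOf (i : Fin 12) (k : Fin 3 → ℤ) :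
    ⟪L (slotSite i), menuOf k⟫_ℝ = (dz (slotInt i) k : ℝ) / Real.sqrt 6 := by
  have h6 : Real.sqrt 6 ≠ 0 := by positivity
  have h66 : Real.sqrt 6 * Real.sqrt 6 = 6 := Real.mul_self_sqrt (by norm_num)
  have h62 : Real.sqrt 6 ^ 2 = 6 := Real.sq_sqrt (by norm_num)
  rw [L_slotSite, menuOf, real_inner_smul_right, Qr.inner_map_map, inner_ipt]
  have : dz (slot3 i) k = 3 * dz (slotInt i) k := by
    simp only [dz, slot3_apply]; ring
  rw [this]; push_cast
  field_simp
  rw [h62]; ring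

/-- The mirrored slot across the plane of the sign vector `k`, in the integer model: `3 sᵢ − 2 (sᵢ·k) k`. -/
def mirrorVec (i : Fin 12) (k : Fin 3 → ℤ) : Fin 3 → ℤ := fun j => 3 * slotInt i j - 2 * dz (slotInt i) k * k j

/-- `mirrorVec` unfolded. -/
theorem mirrorVec_eq (i : Fin 12) (k : Fin 3 → ℤ) : mirrorVec i k = slot3 i - (2 * dz (slotInt i) k) • k := by
  funext j; simp [mirrorVec, slot3_apply]

/-- The mirror of a slot image across `menuOf k`: an integer point again. -/
theorem mirror_slot_menuOf (i : Fin 12) (k : Fin 3 → ℤ) :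
    L (slotSite i) - (2 * ⟪L (slotSite i), menuOf k⟫_ℝ) • menuOf k = Qr (ipt (mirrorVec i k)) := by
  have h6 : Real.sqrt 6 ≠ 0 := by positivity
  rw [mirrorVec_eq, inner_L_slotSite_menuOf, L_slotSite, menuOf, ipt_sub, map_sub, ipt_zsmul, map_smul, smul_smul]
  congr 2
  push_cast
  field_simp

/-- Every menu normal of `L` is `menuOf (cubeInt c)` for one of the eight sign vectors. -/
theorem exists_menuOf_of_menu {m : EuclideanSpace ℝ (Fin 3)} (hm : IsMenuNormal L m) :
    ∃ c : Fin 8, m = menuOf (cubeInt c) := by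
  obtain ⟨k, hk, hkj⟩ := menu_cubic_coords_pm_one L hm.1 hm.2
  have hkR : ∀ j, (k j : ℝ) = 1 ∨ (k j : ℝ) = -1 := by
    intro j; rcases hk j with h | h <;> rw [h] <;> norm_num
  obtain ⟨c, hc0, hc1, hc2⟩ := exists_cubeInt_eq _ _ _ (hkR 0) (hkR 1) (hkR 2)
  have hc : ∀ j, (cubeInt c j : ℝ) = k j := by
    intro j; fin_cases j
    · exact hc0
    · exact hc1
    · exact hc2
  refine ⟨c, ?_⟩
  -- compare coordinates after `L.symm`
  apply L.symm.injective
  have h3 : (0 : ℝ) < Real.sqrt 3 := Real.sqrt_pos.2 (by norm_num)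
  have hcoef : ∀ j, cubicCoords (L.symm m) j = (k j : ℝ) / Real.sqrt 3 := by
    intro j
    rw [← inner_cubicFrame, ← L.inner_map_map, L.apply_symm_apply, real_inner_comm]
    have := hkj j
    field_simp
    linarith
  -- `L.symm (menuOf (cubeInt c))` has the same cubic coordinates
  have hsymm : L.symm (menuOf (cubeInt c)) = Cc.symm (Real.sqrt 6 • ipt (cubeInt c)) := by
    rw [menuOf, L]
    simp [LinearIsometryEquiv.symm_trans]
  apply Cc.injective
  ext j
  rw [Cc_apply, hcoef j, hsymm, Cc.apply_symm_apply, PiLp.smul_apply, smul_eq_mul, ipt_apply, sqrt18_eq, hc j]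
  have h6 : Real.sqrt 6 ≠ 0 := by positivity
  field_simp

/-- The twin-reading FAILURE test at `u` for the sign vector `k`: some slot index witnesses a violated clause. -/
def twinFailS (S : Finset (Fin 3 → ℤ)) (u k : Fin 3 → ℤ) : Bool :=
  decide (∃ i : Fin 12, (dz (slotInt i) k ≤ 0 ∧ u + slot3 i ∉ S) ∨
    (dz (slotInt i) k < 0 ∧ u + mirrorVec i k ∉ S) ∨
    (0 < dz (slotInt i) k ∧ u + slot3 i ∈ S))

/-- The twin-reading SUCCESS test at `u` for the sign vector `k`. -/
def twinOKS (S : Finset (Fin 3 → ℤ)) (u k : Fin 3 → ℤ) : Bool :=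
  decide ((∀ i : Fin 12, dz (slotInt i) k ≤ 0 → u + slot3 i ∈ S) ∧
    (∀ i : Fin 12, dz (slotInt i) k < 0 → u + mirrorVec i k ∈ S) ∧
    (∀ i : Fin 12, 0 < dz (slotInt i) k → u + slot3 i ∉ S))

/-- `√6 > 0`. -/
theorem sqrt6_pos : (0 : ℝ) < Real.sqrt 6 := Real.sqrt_pos.2 (by norm_num)

/-- Adding a tilted model vector to a carried point. -/
theorem P_add_Qr (u w : Fin 3 → ℤ) : P u + Qr (ipt w) = P (u + w) := (P_add u w).symm

/-- No twin reading at `P u` once every sign vector has a failing clause. -/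
theorem not_twinReading {S : Finset (Fin 3 → ℤ)} {u : Fin 3 → ℤ} (h : ∀ c : Fin 8, twinFailS S u (cubeInt c) = true)
    (m : EuclideanSpace ℝ (Fin 3)) : ¬ IsTwinReading (Xof S) L m (P u) := by
  intro htw
  obtain ⟨hmenu, hlow, hmir, hfar⟩ := htw
  obtain ⟨c, rfl⟩ := exists_menuOf_of_menu hmenu
  have hc := h c
  rw [twinFailS, decide_eq_true_iff] at hc
  obtain ⟨i, hi⟩ := hc
  have hin := inner_L_slotSite_menuOf i (cubeInt c)
  have h6 := sqrt6_pos
  rcases hi with ⟨hd, hnot⟩ | ⟨hd, hnot⟩ | ⟨hd, hmem⟩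
  · apply hnot
    have := hlow (slotSite i) (slotSite_mem i) (by
      rw [hin]; exact div_nonpos_of_nonpos_of_nonneg (by exact_mod_cast hd) h6.le)
    rwa [P_add_slot, mem_Xof] at this
  · apply hnot
    have := hmir (slotSite i) (slotSite_mem i) (by
      rw [hin]; exact div_neg_of_neg_of_pos (by exact_mod_cast hd) h6)
    rwa [mirror_slot_menuOf, P_add_Qr, mem_Xof] at this
  · apply hfar (slotSite i) (slotSite_mem i) (by rw [hin]; positivity)
    rw [P_add_slot, mem_Xof]; exact hmem

/-- `menuOf (cubeInt c)` IS a menu normal of `L`. -/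
theorem isMenuNormal_menuOf (c : Fin 8) : IsMenuNormal L (menuOf (cubeInt c)) := by
  have h6 := sqrt6_pos
  have h66 : Real.sqrt 6 * Real.sqrt 6 = 6 := Real.mul_self_sqrt (by norm_num)
  refine ⟨?_, ?_⟩
  · -- unit
    have hsq : ‖menuOf (cubeInt c)‖ ^ 2 = 1 := by
      rw [menuOf, norm_smul, Qr.norm_map, mul_pow, Real.norm_of_nonneg h6.le, norm_ipt_sq, Real.sq_sqrt (by norm_num)]
      have : dz (cubeInt c) (cubeInt c) = 3 := by fin_cases c <;> decide
      rw [this]; norm_num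
    have hn := norm_nonneg (menuOf (cubeInt c))
    nlinarith
  · intro w hw
    obtain ⟨i, rfl⟩ := exists_slotSite_eq hw
    rw [inner_L_slotSite_menuOf]
    have h23 : Real.sqrt (2 / 3) = 2 / Real.sqrt 6 := by
      rw [show (2 : ℝ) / 3 = 4 / 6 by norm_num, Real.sqrt_div (by norm_num), show (4 : ℝ) = 2 ^ 2 by norm_num,
        Real.sqrt_sq (by norm_num)]
    have hdz : dz (slotInt i) (cubeInt c) = 0 ∨ dz (slotInt i) (cubeInt c) = 2 ∨ dz (slotInt i) (cubeInt c) = -2 := by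
      fin_cases i <;> fin_cases c <;> decide
    rcases hdz with hd | hd | hd <;> rw [hd]
    · left; simp
    · right; left; rw [h23]; push_cast; ring
    · right; right; rw [h23]; push_cast; ring

/-- A twin reading at `P u` from the integer success test. -/
theorem twinReading_of {S : Finset (Fin 3 → ℤ)} {u : Fin 3 → ℤ} (c : Fin 8) (h : twinOKS S u (cubeInt c) = true) :
    IsTwinReading (Xof S) L (menuOf (cubeInt c)) (P u) := by
  rw [twinOKS, decide_eq_true_iff] at h
  obtain ⟨hlow, hmir, hfar⟩ := h
  have h6 := sqrt6_pos
  refine ⟨isMenuNormal_menuOf c, ?_, ?_, ?_⟩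
  · intro w hw hle
    obtain ⟨i, rfl⟩ := exists_slotSite_eq hw
    rw [inner_L_slotSite_menuOf] at hle
    have hd : dz (slotInt i) (cubeInt c) ≤ 0 := by
      by_contra hpos
      push Not at hpos
      have : (0 : ℝ) < (dz (slotInt i) (cubeInt c) : ℝ) / Real.sqrt 6 := by positivity
      linarith
    rw [P_add_slot, mem_Xof]; exact hlow i hd
  · intro w hw hlt
    obtain ⟨i, rfl⟩ := exists_slotSite_eq hw
    have hlt' := hlt
    rw [inner_L_slotSite_menuOf] at hlt'
    have hd : dz (slotInt i) (cubeInt c) < 0 := by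
      by_contra hnn
      push Not at hnn
      have : (0 : ℝ) ≤ (dz (slotInt i) (cubeInt c) : ℝ) / Real.sqrt 6 := by positivity
      linarith
    rw [mirror_slot_menuOf, P_add_Qr, mem_Xof]; exact hmir i hd
  · intro w hw hpos
    obtain ⟨i, rfl⟩ := exists_slotSite_eq hw
    rw [inner_L_slotSite_menuOf] at hpos
    have hd : 0 < dz (slotInt i) (cubeInt c) := by
      by_contra hnp
      push Not at hnp
      have : (dz (slotInt i) (cubeInt c) : ℝ) / Real.sqrt 6 ≤ 0 :=
        div_nonpos_of_nonpos_of_nonneg (by exact_mod_cast hnp) h6.le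
      linarith
    rw [P_add_slot, mem_Xof]; exact hfar i hd


/-! ### §5 End pairs and the row in the integer model -/

/-- A ball that is neither full nor twin-reading is not moving under `v1`. -/
theorem not_isMoving {S : Finset (Fin 3 → ℤ)} {u : Fin 3 → ℤ} (d : EuclideanSpace ℝ (Fin 3)) (hfull : fullS S u = false)
    (htw : ∀ c : Fin 8, twinFailS S u (cubeInt c) = true) : ¬ IsMoving (Xof S) WordVersion.v1 L d (P u) := by
  rintro (h | ⟨m, hm, -⟩ | ⟨h, -⟩)
  · have := (isFull_iff S u).1 h
    rw [hfull] at this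
    exact Bool.false_ne_true this
  · exact not_twinReading htw m hm
  · exact absurd h (by decide)

/-- Straight end move `q → b = q + sᵢ` from a FULL predecessor. -/
theorem isEndMove_full {S : Finset (Fin 3 → ℤ)} (q b : Fin 3 → ℤ) (i : Fin 12) (hbq : b = q + slot3 i)
    (hq : fullS S q = true) (hb : fullS S b = false) (htw : ∀ c : Fin 8, twinFailS S b (cubeInt c) = true) :
    IsEndMove (Xof S) WordVersion.v1 L (L (slotSite i)) (P q) (P b) := by
  subst hbq
  exact Or.inl ⟨Or.inl ((isFull_iff S q).2 hq), (P_add_slot q i).symm, not_isMoving _ hb htw⟩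

/-- Straight end move `q → b = q + sᵢ` from a GLIDING predecessor (twin reading across `menuOf (cubeInt c)`, `sᵢ` in its
plane). -/
theorem isEndMove_glide {S : Finset (Fin 3 → ℤ)} (q b : Fin 3 → ℤ) (i : Fin 12) (c : Fin 8) (hbq : b = q + slot3 i)
    (hq : twinOKS S q (cubeInt c) = true) (hperp : dz (slotInt i) (cubeInt c) = 0)
    (hb : fullS S b = false) (htw : ∀ c' : Fin 8, twinFailS S b (cubeInt c') = true) :
    IsEndMove (Xof S) WordVersion.v1 L (L (slotSite i)) (P q) (P b) := by
  subst hbq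
  exact Or.inl ⟨Or.inr (Or.inr ⟨menuOf (cubeInt c), twinReading_of c hq, by
      rw [inner_L_slotSite_menuOf, hperp]; simp⟩),
    (P_add_slot q i).symm, not_isMoving _ hb htw⟩

/-- The bottom and top plate systems of the translation row at the frame `L`. -/
def S1 : PlateSystem := ⟨L, inPlaneRoots L 1⟩

/-- See `S1`. -/
def S2 : PlateSystem := ⟨L, inPlaneRoots L (-1)⟩

/-- Roots are admissible with the empty chain. -/
theorem adm_of_root (T : PlateSystem) (hT : T.G₀ = L) {r : EuclideanSpace ℝ (Fin 3)} (hr : r ∈ T.RT) :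
    T.Adm L (L r) := by
  refine ⟨r, hr, [], ?_, ?_, ?_⟩
  · simp only [WFChain]
  · simp only [PlateSystem.Fw, hT]
  · simp only [PlateSystem.Fw, hT, List.length_nil, pow_zero, one_smul]

/-- In-plane slots with the right rise sign are roots. -/
theorem mem_inPlaneRoots {i : Fin 12} {s : ℝ} (hk : (slotKIJ i).1 = 0)
    (hs : 0 < s * ((-24 * slotInt i 0 - 7 * slotInt i 2 : ℤ) : ℝ)) : slotSite i ∈ inPlaneRoots L s := by
  rw [inPlaneRoots, Finset.mem_filter]
  refine ⟨slotSite_mem i, ?_, ?_⟩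
  · rw [slotSite_two, hk]; simp
  · rw [L_slotSite_two]
    have h3 : (0 : ℝ) < 3 / (25 * Real.sqrt 18) := by positivity
    have : s * (3 / (25 * Real.sqrt 18) * ((-24 * slotInt i 0 - 7 * slotInt i 2 : ℤ) : ℝ)) =
        3 / (25 * Real.sqrt 18) * (s * ((-24 * slotInt i 0 - 7 * slotInt i 2 : ℤ) : ℝ)) := by ring
    rw [this]; exact mul_pos h3 hs

/-- An end pair of the integer model. -/
theorem isEndPair_of {S : Finset (Fin 3 → ℤ)} {b q : Fin 3 → ℤ} (hq : q ∈ S) (hb : b ∈ S) (hdeg : degS S b ≤ 11)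
    {i : Fin 12} (hroot : slotSite i ∈ inPlaneRoots L 1 ∨ slotSite i ∈ inPlaneRoots L (-1))
    (hmove : IsEndMove (Xof S) WordVersion.v1 L (L (slotSite i)) (P q) (P b)) :
    IsEndPair (Xof S) WordVersion.v1 S1 S2 (P b) (P q) :=
  ⟨mem_Xof.2 hq, mem_Xof.2 hb, hasTwoPayers_of_deg hdeg, L, L (slotSite i),
    hroot.imp (adm_of_root S1 rfl) (adm_of_root S2 rfl), hmove⟩

open scoped Classical in
/-- Exhibited end pairs bound the end multiplicity from below. -/
theorem le_endMult {S : Finset (Fin 3 → ℤ)} (b : Fin 3 → ℤ) (Q : Finset (Fin 3 → ℤ))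
    (hQ : ∀ q ∈ Q, IsEndPair (Xof S) WordVersion.v1 S1 S2 (P b) (P q)) :
    Q.card ≤ endMult (Xof S) WordVersion.v1 S1 S2 (P b) := by
  unfold endMult
  rw [← Finset.card_map Pemb]
  apply Finset.card_le_card
  intro x hx
  rw [Finset.mem_map] at hx
  obtain ⟨q, hq, rfl⟩ := hx
  rw [Finset.mem_filter]
  exact ⟨(hQ q hq).1, hQ q hq⟩

/-- Pooled deficiencies are non-negative. -/
theorem pooledDef_nonneg (X : Finset (EuclideanSpace ℝ (Fin 3))) (b : EuclideanSpace ℝ (Fin 3)) : 0 ≤ pooledDef X b := by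
  unfold pooledDef
  apply Finset.sum_nonneg
  intro z hz
  rw [Finset.mem_filter] at hz
  have : ((X.filter fun q => dist z q = 1).card : ℝ) ≤ 11 := by exact_mod_cast hz.2.2
  linarith

/-- Roots from a non-zero rise number: the slot rises (`s = 1`) or falls (`s = −1`). -/
theorem root_of_ne {i : Fin 12} (hk : (slotKIJ i).1 = 0) (hN : (-24 * slotInt i 0 - 7 * slotInt i 2 : ℤ) ≠ 0) :
    slotSite i ∈ inPlaneRoots L 1 ∨ slotSite i ∈ inPlaneRoots L (-1) := by
  rcases lt_or_gt_of_ne hN with h | h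
  · right; apply mem_inPlaneRoots hk
    have : ((-24 * slotInt i 0 - 7 * slotInt i 2 : ℤ) : ℝ) < 0 := by exact_mod_cast h
    linarith
  · left; apply mem_inPlaneRoots hk
    have : (0 : ℝ) < ((-24 * slotInt i 0 - 7 * slotInt i 2 : ℤ) : ℝ) := by exact_mod_cast h
    linarith

open scoped Classical in
/-- **Indexed form of the row domination.** -/
theorem sum_le_of_localEndRow' {S : Finset (Fin 3 → ℤ)} (hsep : ∀ u ∈ S, ∀ v ∈ S, u ≠ v → 18 ≤ dz (u - v) (u - v))
    {sF : ℝ} (hrow : LocalEndRow WordVersion.v1 sF S1 S2) (uz : Fin 3 → ℤ) (hz : uz ∈ S) (hzdeg : degS S uz ≤ 11)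
    {ι : Type*} (B : Finset ι) (pt : ι → (Fin 3 → ℤ)) (hinj : Set.InjOn pt B) (m : ι → ℕ)
    (hnear : ∀ j ∈ B, dz (uz - pt j) (uz - pt j) ≤ 18)
    (hm : ∀ j ∈ B, m j ≤ endMult (Xof S) WordVersion.v1 S1 S2 (P (pt j)))
    (hmpos : ∀ j ∈ B, 0 < m j) (hpool : ∀ j ∈ B, 0 < pooledS S (pt j)) :
    ∑ j ∈ B, (m j : ℝ) / (pooledS S (pt j) : ℝ) ≤ sF := by
  have hX := sep_Xof hsep
  have hzpay : ((Xof S).filter fun q => dist (P uz) q = 1).card ≤ 11 := by rw [card_contacts]; exact hzdeg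
  have h := hrow (Xof S) hX (P uz) (mem_Xof.2 hz) hzpay
  refine le_trans ?_ h
  have hinj' : Set.InjOn (fun j => P (pt j)) B := fun j hj j' hj' e => hinj hj hj' (P_injective e)
  have hsub : B.image (fun j => P (pt j)) ⊆
      (Xof S).filter (fun b => dist (P uz) b ≤ 1 ∧ 0 < endMult (Xof S) WordVersion.v1 S1 S2 b) := by
    intro x hx
    rw [Finset.mem_image] at hx
    obtain ⟨j, hj, rfl⟩ := hx
    rw [Finset.mem_filter]
    have hpos : 0 < endMult (Xof S) WordVersion.v1 S1 S2 (P (pt j)) := lt_of_lt_of_le (hmpos j hj) (hm j hj)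
    have hbX : P (pt j) ∈ Xof S := by
      have hpos' := hpos
      unfold endMult at hpos'
      obtain ⟨q, hq⟩ := Finset.card_pos.1 hpos'
      rw [Finset.mem_filter] at hq
      exact hq.2.2.1
    exact ⟨hbX, (dist_P_le_one_iff uz (pt j)).2 (hnear j hj), hpos⟩
  calc ∑ j ∈ B, (m j : ℝ) / (pooledS S (pt j) : ℝ)
      ≤ ∑ j ∈ B, (endMult (Xof S) WordVersion.v1 S1 S2 (P (pt j)) : ℝ) / pooledDef (Xof S) (P (pt j)) := by
        apply Finset.sum_le_sum
        intro j hj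
        rw [pooledDef_eq]
        exact div_le_div_of_nonneg_right (by exact_mod_cast hm j hj) (by exact_mod_cast (hpool j hj).le)
    _ = ∑ x ∈ B.image (fun j => P (pt j)), (endMult (Xof S) WordVersion.v1 S1 S2 x : ℝ) / pooledDef (Xof S) x := by
        rw [Finset.sum_image hinj']
    _ ≤ _ := by
        apply Finset.sum_le_sum_of_subset_of_nonneg hsub
        intro x _ _
        exact div_nonneg (Nat.cast_nonneg _) (pooledDef_nonneg _ _)


end EndRowFloor

end Summit.Ventures.Crystal3D.Theorems

end
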